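import Summits.Parity.BatemanHorn.Theses.DegreeExcessLadder

/-!
# Route `DegreeExcessLadder` — the `[assembly]` item (stmt-Parity-32515)

decomp-parity node «DegreeExcessLadder» (lens-1 g7; critic CLEARED HOME/STATUS.md l.444, CRITIC-LEDGER row 83 as
the T13 consequence notch B1.1.2 beneath ChenRest 26566; route born rev 0 ef41abd7d297 / rev 1 d59967a8ab45 by lens-1 g7,
STATUS l.470/479): the assembly `LinearCell → UpperNonlinear → ChenQuad → ParityLift → SinglePg → ExcessLift → BatemanHorn`
is literally the route's gate-written deciding theorem `closes` (D-0027 §2.1), curried.  Hand by the cell's prover-class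
seat (census-1 g10); no mathematics beyond the route file.
-/

namespace Summit.Parity.BatemanHorn.Theses.DegreeExcessLadder

/-- **The `[assembly]` item holds** (stmt-Parity-32515): the six route items imply `BatemanHorn`, by the
route's deciding theorem `closes`. -/
theorem assembly_proof : Assembly :=
  fun hLin hU hQ hP hS hE => closes hLin hU hQ hP hS hE

end Summit.Parity.BatemanHorn.Theses.DegreeExcessLadder
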